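import Summits.BirchSwinnertonDyer.BirchSwinnertonDyer.Theorems.SmallImageMuTransferMuTransferX9StepTwoLocal
import Summits.BirchSwinnertonDyer.BirchSwinnertonDyer.Theorems.KatoDescentPotSupersingularMuCoreIrrImageFacts
import HarnessLib

/-!
# The K6 `μ`-core under IMAGE FACTS instead of `ρ̄` not onto — part D: STEP 2 (the coset representative with
# prescribed `κ`-value and depth, the Chebotarev prime, the distinguished local Frobenius), at every prime
# (route `KatoDescentPotSupersingular`, U₀ parent item stmt-BirchSwinnertonDyer-19197 / U₀-ns node 19189;
# route-free helper)

Seat `bsd-potss-k9-c4` g14 (prover; cell `bsd-potss`); `--supports stmt-BirchSwinnertonDyer-19197 --as helper`;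
closes nothing.  HONEST FRAMING: BSD is not proved by any of this; nothing is booked; THEOREMS ONLY; the
mathematics and the proof texts are the K6 cells' (`b2b-bsdres` x9 GEN 43–44, `bsd-smallim` k6-c2:
`…X9StepTwoElement`, `…X9StepTwoElementKernels`, `…X9StepTwoLocal`; MU-TRANSFER-PROOF §5 STEP 2); this file
only re-keys the hypothesis `¬ W.HasSurjectiveModNGaloisRep p` into the image facts (SC) (a Galois scalar `≠ 1`
on `E[p]`) and (IF) (no normal index-`p` subgroup of `Γ_ℚ` above `ker ρ̄_{E,p}`) of part A
(`…MuCoreIrrImageFacts`), both theorems at `p = 3` for every `E[3]`-irreducible curve.  The binders `p ≠ 2`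
and `E[p]` irreducible of the originals were consumed only by the re-keyed inputs and are dropped.

* `exists_mem_apply_eq_and_apply_eq_of_imageFacts`, `exists_mem_apply_eq_and_depth_of_imageFacts`,
  `exists_mem_inf_ker_apply_eq_and_depth_of_imageFacts`,
  `exists_isArithFrobAt_mem_inf_ker_apply_eq_and_depth_of_imageFacts`,
  `exists_forall_isAbsArithFrob_mem_inf_ker_apply_eq_smul_and_depth_of_imageFacts`.

References: [Serre1972] §2.4 Prop. 15, §2.6; [Sah1968] Prop. 2.7 (b); [Washington1997] §13.1–13.2;
[TateGCFT1967] §2.4; [NeukirchANT1999] I §9, II §9; [SerreLocalFields1979] I §8, VII §5.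
-/

-- the summit and its single problem are both named `BirchSwinnertonDyer` (registry layout D-0017)
set_option linter.dupNamespace false
set_option autoImplicit false

noncomputable section

open scoped NumberField
open Field WeierstrassCurve Literature.NumberTheory.EllipticCurves
  Literature.NumberTheory.GaloisRepresentations Function IsDedekindDomain NumberField
open Literature.NumberTheory.GaloisRepresentations.IsNonarchimedeanLocalField
open Literature.NumberTheory.Automorphic

namespace Summit.BirchSwinnertonDyer.BirchSwinnertonDyer.Rank1Residual

variable (W : WeierstrassCurve ℚ) [W.IsElliptic] (p : ℕ) [Fact p.Prime] (κ κ' : ZpExtension ℚ p)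

/-! ## §1 The coset representative (twins of `…X9StepTwoElement` §Rat) -/

/-- (Twin of `exists_mem_apply_eq_and_apply_eq_of_ne_two` with the image facts (SC)/(IF) in place of `ρ̄_{E,p}` not onto; K6 proof text verbatim.) **MU-TRANSFER-PROOF §5 STEP 2, the coset representative with prescribed `κ`-value.** `E/ℚ`,
`p` odd, `E[p]` irreducible, `ρ̄_{E,p}` not onto; `κ` any `ℤ_p`-extension of `ℚ` and `κ'` one with
the same kernel (e.g. `κ' = κ.invTwist`, the dual deformation). Let `H ⊴ Γ_ℚ` act trivially on
`𝒯_J(E, κ)` and `𝒯_{J'}(E, κ')`, `φ`, `ψ` continuous 1-cocycles in these, `M = (φ, ψ)(H)` their joint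
value group. Then for every `σ₁ ∈ H` and every `w ∈ M` there is `σ ∈ H` with `(φ σ, ψ σ) = w` and
`κ σ = κ σ₁`. (§1 with `z = σ₀ ∈ ker κ` the central scalar of GEN 42, acting as `a ≠ 1` on both
twists, `m = (a−1)⁻¹ mod p`, `χ = κ`.) [cite: Serre1972, §2.4 Prop. 15 and §2.6]
[cite: Sah1968, Prop. 2.7 (b)] [cite: Washington1997, §13.1–§13.2] -/
theorem exists_mem_apply_eq_and_apply_eq_of_imageFacts
    (hSC : ∃ (z : absoluteGaloisGroup ℚ) (a : ZMod p), a ≠ 1 ∧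
      ∀ P : geomTorsion W (p : ℤ), z • P = a.val • P)
    (hIF : ∀ N : Subgroup (absoluteGaloisGroup ℚ), N.Normal →
      (galoisRepTorsion W (p : ℕ)).ker ≤ N → N.index ≠ p)
    (hker : κ'.kerSubgroup = κ.kerSubgroup) (J J' : ℕ)
    (φ : contOneCocycles (W.modPTwist p κ J).toTopRep)
    (ψ : contOneCocycles (W.modPTwist p κ' J').toTopRep)
    (H : Subgroup (absoluteGaloisGroup ℚ)) [H.Normal]
    (hX : ∀ τ ∈ H, ∀ x : (W.modPTwist p κ J).toTopRep, (W.modPTwist p κ J).toTopRep.ρ τ x = x)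
    (hY : ∀ τ ∈ H, ∀ y : (W.modPTwist p κ' J').toTopRep, (W.modPTwist p κ' J').toTopRep.ρ τ y = y)
    {σ₁ : absoluteGaloisGroup ℚ} (hσ₁ : σ₁ ∈ H) {w : (W.modPTwist p κ J).toTopRep × (W.modPTwist p κ' J').toTopRep}
    (hw : w ∈ contOneCocycles.jointValueSubgroup φ ψ H hX hY) :
    ∃ σ ∈ H, κ σ = κ σ₁ ∧ φ.1 σ = w.1 ∧ ψ.1 σ = w.2 := by
  obtain ⟨σ₀, a, ha, hκ, hσ₀⟩ := exists_mem_kerSubgroup_smul_eq_of_imageFacts W p κ hSC hIF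
  have hκ' : σ₀ ∈ κ'.kerSubgroup := hker ▸ hκ
  exact JointValue.exists_mem_map_eq_apply_eq φ ψ H hX hY κ (fun g => mul_comm _ _)
    (val_inv_sub_one_nsmul_rho_sub_eq W p κ J ha hσ₀ hκ)
    (val_inv_sub_one_nsmul_rho_sub_eq W p κ' J' ha hσ₀ hκ') hσ₁ hw

/-- (Twin of `exists_mem_apply_eq_and_depth_of_ne_two` with the image facts (SC)/(IF) in place of `ρ̄_{E,p}` not onto; K6 proof text verbatim.) **MU-TRANSFER-PROOF §5 STEP 2, the Chebotarev coset representative** («`Frob|_{L'} =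
(1_{L₀}; (x, x^*), t)`, `t ≠ 0`», as an element of `Γ_ℚ`). Same setting, with
`G_{L₀} = ker ρ̄_{E,p} ⊓ Gal(ℚ̄/ℚ_n) ≤ H ≤ ker ρ̄_{E,p}`: for every joint value `w ∈ M = (φ, ψ)(H)`
there is `σ ∈ H` with `(φ σ, ψ σ) = w`, `ρ̄_{E,p}(σ) = 1`, `σ ∈ Gal(ℚ̄/ℚ_n)` and `σ ∉ Gal(ℚ̄/ℚ_{n+1})`
(depth exactly `n`: the `E`-split prime of depth `e_q = p^n` after Chebotarev). The depth comes from
GEN 42's element of `ker ρ̄ ⊓ Gal(ℚ̄/ℚ_n) ∖ Gal(ℚ̄/ℚ_{n+1})` ("`μ_{p^{m₀+1}} ⊄ L₀`").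
[cite: Serre1972, §2.4 Prop. 15 and §2.6] [cite: Sah1968, Prop. 2.7 (b)]
[cite: Washington1997, §13.1–§13.2] -/
theorem exists_mem_apply_eq_and_depth_of_imageFacts
    (hSC : ∃ (z : absoluteGaloisGroup ℚ) (a : ZMod p), a ≠ 1 ∧
      ∀ P : geomTorsion W (p : ℤ), z • P = a.val • P)
    (hIF : ∀ N : Subgroup (absoluteGaloisGroup ℚ), N.Normal →
      (galoisRepTorsion W (p : ℕ)).ker ≤ N → N.index ≠ p)
    (hker : κ'.kerSubgroup = κ.kerSubgroup) (J J' n : ℕ)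
    (φ : contOneCocycles (W.modPTwist p κ J).toTopRep)
    (ψ : contOneCocycles (W.modPTwist p κ' J').toTopRep)
    (H : Subgroup (absoluteGaloisGroup ℚ)) [H.Normal]
    (hX : ∀ τ ∈ H, ∀ x : (W.modPTwist p κ J).toTopRep, (W.modPTwist p κ J).toTopRep.ρ τ x = x)
    (hY : ∀ τ ∈ H, ∀ y : (W.modPTwist p κ' J').toTopRep, (W.modPTwist p κ' J').toTopRep.ρ τ y = y)
    (hH : (galoisRepTorsion W p).ker ⊓ κ.layerSubgroup n ≤ H)
    (hHker : H ≤ (galoisRepTorsion W p).ker)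
    {w : (W.modPTwist p κ J).toTopRep × (W.modPTwist p κ' J').toTopRep}
    (hw : w ∈ contOneCocycles.jointValueSubgroup φ ψ H hX hY) :
    ∃ σ ∈ H, φ.1 σ = w.1 ∧ ψ.1 σ = w.2 ∧ galoisRepTorsion W p σ = 1 ∧
      σ ∈ κ.layerSubgroup n ∧ σ ∉ κ.layerSubgroup (n + 1) := by
  obtain ⟨σ₁, hσ₁, hσ₁'⟩ :=
    exists_mem_ker_inf_layerSubgroup_not_mem_layerSubgroup_succ_of_IF W p κ hIF n
  obtain ⟨σ, hσ, hκσ, hφ, hψ⟩ := exists_mem_apply_eq_and_apply_eq_of_imageFacts W p κ κ' hSC hIF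
    hker J J' φ ψ H hX hY (hH hσ₁) hw
  refine ⟨σ, hσ, hφ, hψ, MonoidHom.mem_ker.mp (hHker hσ), ?_, ?_⟩
  · exact (mem_layerSubgroup_iff_of_apply_eq p κ hκσ n).mpr (Subgroup.mem_inf.mp hσ₁).2
  · exact fun h => hσ₁' ((mem_layerSubgroup_iff_of_apply_eq p κ hκσ (n + 1)).mp h)

/-! ## §2 On k6-c2's joint kernel; the Chebotarev prime (twins of `…X9StepTwoElementKernels` §4, §7) -/

/-- (Twin of `exists_mem_inf_ker_apply_eq_and_depth_of_ne_two` with the image facts (SC)/(IF) in place of `ρ̄_{E,p}` not onto; K6 proof text verbatim.) **STEP 2's coset representative on k6-c2's joint kernel** `H = N_J(κ) ⊓ N_{J'}(κ.invTwist)`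
(`N_J(κ) = ker(Γ_ℚ → Aut 𝒯_J(E, κ))`, the subgroup of `…X9StepOneSahJoint` / `…X9StepOneDual` on
which both test classes `h`, `h^*` live), `1 ≤ J ≤ p^n`, `J' ≤ p^n`, `p` odd, `E[p]` irreducible,
`ρ̄_{E,p}` not onto: every joint value `w ∈ M = (φ, ψ)(H)` is `(φ σ, ψ σ)` for some `σ ∈ H` with
`ρ̄_{E,p}(σ) = 1`, `σ ∈ Gal(ℚ̄/ℚ_n)`, `σ ∉ Gal(ℚ̄/ℚ_{n+1})`. [cite: Serre1972, §2.4 Prop. 15 and §2.6]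
[cite: Sah1968, Prop. 2.7 (b)] [cite: Washington1997, §13.1–§13.2] -/
theorem exists_mem_inf_ker_apply_eq_and_depth_of_imageFacts
    (hSC : ∃ (z : absoluteGaloisGroup ℚ) (a : ZMod p), a ≠ 1 ∧
      ∀ P : geomTorsion W (p : ℤ), z • P = a.val • P)
    (hIF : ∀ N : Subgroup (absoluteGaloisGroup ℚ), N.Normal →
      (galoisRepTorsion W (p : ℕ)).ker ≤ N → N.index ≠ p)
    {J J' n : ℕ} (hJ0 : 0 < J) (hJ : J ≤ p ^ n) (hJ' : J' ≤ p ^ n)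
    (φ : contOneCocycles (W.modPTwist p κ J).toTopRep)
    (ψ : contOneCocycles (W.modPTwist p κ.invTwist J').toTopRep)
    {w : (W.modPTwist p κ J).toTopRep × (W.modPTwist p κ.invTwist J').toTopRep}
    (hw : w ∈ contOneCocycles.jointValueSubgroup φ ψ
      ((κ.twistModPRepresentation (W.torsionGaloisModule (p : ℤ))
          (fun P : geomTorsion W (p : ℤ) => AddSubgroup.torsionBy.nsmul P) J).ker ⊓
        (κ.invTwist.twistModPRepresentation (W.torsionGaloisModule (p : ℤ))
          (fun P : geomTorsion W (p : ℤ) => AddSubgroup.torsionBy.nsmul P) J').ker)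
      (fun _ hτ x => κ.toTopRep_ρ_apply_eq_self_of_mem_ker (W.torsionGaloisModule (p : ℤ)) _ J
        (Subgroup.mem_inf.mp hτ).1 x)
      (fun _ hτ y => κ.invTwist.toTopRep_ρ_apply_eq_self_of_mem_ker (W.torsionGaloisModule (p : ℤ))
        _ J' (Subgroup.mem_inf.mp hτ).2 y)) :
    ∃ σ ∈ (κ.twistModPRepresentation (W.torsionGaloisModule (p : ℤ))
          (fun P : geomTorsion W (p : ℤ) => AddSubgroup.torsionBy.nsmul P) J).ker ⊓
        (κ.invTwist.twistModPRepresentation (W.torsionGaloisModule (p : ℤ))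
          (fun P : geomTorsion W (p : ℤ) => AddSubgroup.torsionBy.nsmul P) J').ker,
      φ.1 σ = w.1 ∧ ψ.1 σ = w.2 ∧ galoisRepTorsion W p σ = 1 ∧
        σ ∈ κ.layerSubgroup n ∧ σ ∉ κ.layerSubgroup (n + 1) := by
  refine exists_mem_apply_eq_and_depth_of_imageFacts W p κ κ.invTwist hSC hIF
    (ZpExtension.kerSubgroup_unitTwist κ (-1)) J J' n φ ψ _ _ _ (le_inf ?_ ?_)
    (inf_le_left.trans (ker_twistModPRepresentation_le_ker W p κ hJ0)) hw
  · exact ker_inf_layerSubgroup_le_ker_twistModPRepresentation W p κ hJ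
  · rw [← ZpExtension.layerSubgroup_invTwist κ n]
    exact ker_inf_layerSubgroup_le_ker_twistModPRepresentation W p κ.invTwist hJ'

/-- (Twin of `exists_isArithFrobAt_mem_inf_ker_apply_eq_and_depth_of_ne_two` with the image facts (SC)/(IF) in place of `ρ̄_{E,p}` not onto; K6 proof text verbatim.) **MU-TRANSFER-PROOF §5 STEP 2 on the genuine objects, end-to-end** (`p` odd, `E[p]` irreducible,
`ρ̄_{E,p}` not onto; `H = N_J(κ) ⊓ N_{J'}(κ⁻¹)` k6-c2's joint kernel, `1 ≤ J ≤ pⁿ`, `J' ≤ pⁿ`).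
For every joint value `w = (x, x^*) ∈ M = (φ, ψ)(H)` and every finite set `S` of places of `ℚ` there
are an open normal subgroup `N ≤ H ⊓ Gal(ℚ̄/ℚ_{n+1})` killed by `φ` and `ψ` («`N = Gal(ℚ̄/L')`,
`L' = L_M·ℚ_{n+1} ⊇ L₀(μ_{p^{m₀+1}})`») and a place `v ∉ S` UNRAMIFIED for `N` with an arithmetic
Frobenius `Fr` above it such that `Fr ∈ H`, `(φ Fr, ψ Fr) = (x, x^*)`, `ρ̄_{E,p}(Fr) = 1` (`v` is
`E`-split), `Fr ∈ Gal(ℚ̄/ℚ_n) ∖ Gal(ℚ̄/ℚ_{n+1})` (depth exactly `n`: `e_q = pⁿ = e`). Element: §4;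
primes: Chebotarev for open normal subgroups (tree `exists_isArithFrobAt_mul_inv_mem_not_mem`).
[cite: Serre1972, §2.4 Prop. 15 and §2.6] [cite: Sah1968, Prop. 2.7 (b)]
[cite: TateGCFT1967, §2.4 (Tchebotarev density theorem) with Prop. 2.3]
[cite: Washington1997, §13.1–§13.2] -/
theorem exists_isArithFrobAt_mem_inf_ker_apply_eq_and_depth_of_imageFacts
    (hSC : ∃ (z : absoluteGaloisGroup ℚ) (a : ZMod p), a ≠ 1 ∧
      ∀ P : geomTorsion W (p : ℤ), z • P = a.val • P)
    (hIF : ∀ N : Subgroup (absoluteGaloisGroup ℚ), N.Normal →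
      (galoisRepTorsion W (p : ℕ)).ker ≤ N → N.index ≠ p)
    {J J' n : ℕ} (hJ0 : 0 < J) (hJ : J ≤ p ^ n) (hJ' : J' ≤ p ^ n)
    (φ : contOneCocycles (W.modPTwist p κ J).toTopRep)
    (ψ : contOneCocycles (W.modPTwist p κ.invTwist J').toTopRep)
    {w : (W.modPTwist p κ J).toTopRep × (W.modPTwist p κ.invTwist J').toTopRep}
    (hw : w ∈ contOneCocycles.jointValueSubgroup φ ψ
      ((κ.twistModPRepresentation (W.torsionGaloisModule (p : ℤ))
          (fun P : geomTorsion W (p : ℤ) => AddSubgroup.torsionBy.nsmul P) J).ker ⊓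
        (κ.invTwist.twistModPRepresentation (W.torsionGaloisModule (p : ℤ))
          (fun P : geomTorsion W (p : ℤ) => AddSubgroup.torsionBy.nsmul P) J').ker)
      (fun _ hτ x => κ.toTopRep_ρ_apply_eq_self_of_mem_ker (W.torsionGaloisModule (p : ℤ)) _ J
        (Subgroup.mem_inf.mp hτ).1 x)
      (fun _ hτ y => κ.invTwist.toTopRep_ρ_apply_eq_self_of_mem_ker (W.torsionGaloisModule (p : ℤ))
        _ J' (Subgroup.mem_inf.mp hτ).2 y))
    (S : Set (HeightOneSpectrum (𝓞 ℚ))) (hS : S.Finite) :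
    ∃ N : Subgroup (absoluteGaloisGroup ℚ), N.Normal ∧ IsOpen (N : Set (absoluteGaloisGroup ℚ)) ∧
      N ≤ (κ.twistModPRepresentation (W.torsionGaloisModule (p : ℤ))
          (fun P : geomTorsion W (p : ℤ) => AddSubgroup.torsionBy.nsmul P) J).ker ⊓
        (κ.invTwist.twistModPRepresentation (W.torsionGaloisModule (p : ℤ))
          (fun P : geomTorsion W (p : ℤ) => AddSubgroup.torsionBy.nsmul P) J').ker ∧
      N ≤ κ.layerSubgroup (n + 1) ∧ (∀ σ ∈ N, φ.1 σ = 0) ∧ (∀ σ ∈ N, ψ.1 σ = 0) ∧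
      ∃ v ∉ S, SubgroupIsUnramifiedAt ℚ N v ∧
        ∃ 𝔓 ∈ v.primesAbove, ∃ Fr : absoluteGaloisGroup ℚ, IsArithFrobAt (𝓞 ℚ) Fr 𝔓 ∧
          Fr ∈ (κ.twistModPRepresentation (W.torsionGaloisModule (p : ℤ))
              (fun P : geomTorsion W (p : ℤ) => AddSubgroup.torsionBy.nsmul P) J).ker ⊓
            (κ.invTwist.twistModPRepresentation (W.torsionGaloisModule (p : ℤ))
              (fun P : geomTorsion W (p : ℤ) => AddSubgroup.torsionBy.nsmul P) J').ker ∧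
          φ.1 Fr = w.1 ∧ ψ.1 Fr = w.2 ∧ galoisRepTorsion W p Fr = 1 ∧
          Fr ∈ κ.layerSubgroup n ∧ Fr ∉ κ.layerSubgroup (n + 1) := by
  have hp : p.Prime := Fact.out
  haveI : Finite (geomTorsion W (p : ℤ)) :=
    WeierstrassCurve.finite_torsionPoints_holds W (AlgebraicClosure ℚ) (by exact_mod_cast hp.ne_zero)
  -- the element `g` of §4
  obtain ⟨g, hgH, hφg, hψg, -, hgn, hgn1⟩ :=
    exists_mem_inf_ker_apply_eq_and_depth_of_imageFacts W p κ hSC hIF hJ0 hJ hJ' φ ψ hw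
  -- the open normal subgroup `N = Gal(ℚ̄/L')`
  have hHo : IsOpen (((κ.twistModPRepresentation (W.torsionGaloisModule (p : ℤ))
          (fun P : geomTorsion W (p : ℤ) => AddSubgroup.torsionBy.nsmul P) J).ker ⊓
        (κ.invTwist.twistModPRepresentation (W.torsionGaloisModule (p : ℤ))
          (fun P : geomTorsion W (p : ℤ) => AddSubgroup.torsionBy.nsmul P) J').ker :
        Subgroup (absoluteGaloisGroup ℚ)) : Set (absoluteGaloisGroup ℚ)) :=
    (κ.isOpen_ker_twistModPRepresentation (W.torsionGaloisModule (p : ℤ)) _ J).inter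
      (κ.invTwist.isOpen_ker_twistModPRepresentation (W.torsionGaloisModule (p : ℤ)) _ J')
  obtain ⟨N, hNn, hNo, hNH, hNL, hNφ, hNψ⟩ :=
    JointValue.exists_normal_isOpen_le_forall_apply_eq_zero φ ψ _
      (fun _ hτ x => κ.toTopRep_ρ_apply_eq_self_of_mem_ker (W.torsionGaloisModule (p : ℤ)) _ J
        (Subgroup.mem_inf.mp hτ).1 x)
      (fun _ hτ y => κ.invTwist.toTopRep_ρ_apply_eq_self_of_mem_ker (W.torsionGaloisModule (p : ℤ))
        _ J' (Subgroup.mem_inf.mp hτ).2 y)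
      hHo (κ.layerSubgroup (n + 1)) (κ.isOpen_layerSubgroup (n + 1)) (isOpen_discrete _)
      (isOpen_discrete _)
  haveI := hNn
  -- Chebotarev in `ℚ̄^N / ℚ` at the class of `g`
  obtain ⟨v, hvS, hunr, 𝔓, h𝔓, Fr, hFr, hFrg⟩ :=
    exists_isArithFrobAt_mul_inv_mem_not_mem ℚ N hNo g S hS
  obtain ⟨hFrH, hφFr⟩ := JointValue.mem_and_apply_eq_of_mul_inv_mem φ _
    (fun _ hτ x => κ.toTopRep_ρ_apply_eq_self_of_mem_ker (W.torsionGaloisModule (p : ℤ)) _ J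
      (Subgroup.mem_inf.mp hτ).1 x) hNH hNφ hgH hFrg
  obtain ⟨-, hψFr⟩ := JointValue.mem_and_apply_eq_of_mul_inv_mem ψ _
    (fun _ hτ y => κ.invTwist.toTopRep_ρ_apply_eq_self_of_mem_ker (W.torsionGaloisModule (p : ℤ))
      _ J' (Subgroup.mem_inf.mp hτ).2 y) hNH hNψ hgH hFrg
  refine ⟨N, hNn, hNo, hNH, hNL, hNφ, hNψ, v, hvS, hunr, 𝔓, h𝔓, Fr, hFr, hFrH, hφFr.trans hφg,
    hψFr.trans hψg, ?_, ?_, ?_⟩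
  · exact MonoidHom.mem_ker.mp
      ((inf_le_left.trans (ker_twistModPRepresentation_le_ker W p κ hJ0)) hFrH)
  · exact (JointValue.mem_iff_mem_of_mul_inv_mem
      (hNL.trans (κ.layerSubgroup_antitone (Nat.le_succ n))) hFrg).mpr hgn
  · exact fun h => hgn1 ((JointValue.mem_iff_mem_of_mul_inv_mem hNL hFrg).mp h)

/-! ## §3 At the distinguished local Frobenius (twin of `…X9StepTwoLocal` §3) -/

/-- (Twin of `exists_forall_isAbsArithFrob_mem_inf_ker_apply_eq_smul_and_depth_of_ne_two` with the image facts (SC)/(IF) in place of `ρ̄_{E,p}` not onto; K6 proof text verbatim.) **MU-TRANSFER-PROOF §5 STEP 2 at the DISTINGUISHED local Frobenius** (`p` odd, `E[p]`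
irreducible, `ρ̄_{E,p}` not onto; `H = N_J(κ) ⊓ N_{J'}(κ⁻¹)` k6-c2's joint kernel, `1 ≤ J ≤ pⁿ`,
`J' ≤ pⁿ`).  For every joint value `w = (x, x^*) ∈ M = (φ, ψ)(H)` and every finite set `S` of finite
places of `ℚ` there are: an open normal subgroup `N ≤ H ⊓ Gal(ℚ̄/ℚ_{n+1})` killed by `φ` and `ψ`
(«`Gal(ℚ̄/L')`»); a place `v ∉ S` unramified for `N` — hence unramified for `E[p]`
(`GaloisRep.IsUnramifiedAt v (W.torsionGaloisModule p)`: inertia `≤ N ≤ H ≤ ker ρ̄`) —; and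
`t ∈ Γ_ℚ` with `t•w = (t·x, t·x^*) ∈ M`, such that EVERY arithmetic Frobenius `Fr_v` of the local
field `ℚ_v` (restricted along the tree's fixed embedding `absGaloisRestrict ℚ ℚ_v`, the one seen by
`GaloisRep.toLocal v`, the localisation maps and the Poitou–Tate local terms) satisfies:
`res Fr_v ∈ H`, `(φ (res Fr_v), ψ (res Fr_v)) = t•w`, `ρ̄_{E,p}(res Fr_v) = 1` (both spellings:
`v` is `E`-split, koly's `hsplit`), `res Fr_v ∈ Gal(ℚ̄/ℚ_n) ∖ Gal(ℚ̄/ℚ_{n+1})` (depth exactly `n`: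
`e_q = pⁿ = e`, koly's `hφm`/`hφm'`).  The joint value is a TRANSLATE of `w`, not `w`: see the
module docstring; Lemma 4's valuation is translation-invariant by `⟨g x, g x^*⟩ = ω(g)⟨x, x^*⟩`.
[cite: TateGCFT1967, §2.4 (Tchebotarev density theorem) with Prop. 2.3]
[cite: NeukirchANT1999, Ch. I §9 Prop. (9.1) and Ch. II §9 Prop. (9.6)]
[cite: SerreLocalFields1979, Ch. I §8 and VII §5 Prop. 3] [cite: Serre1972, §2.4 Prop. 15 and §2.6]
[cite: Sah1968, Prop. 2.7 (b)] [cite: Washington1997, §13.1–§13.2] -/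
theorem exists_forall_isAbsArithFrob_mem_inf_ker_apply_eq_smul_and_depth_of_imageFacts
    (hSC : ∃ (z : absoluteGaloisGroup ℚ) (a : ZMod p), a ≠ 1 ∧
      ∀ P : geomTorsion W (p : ℤ), z • P = a.val • P)
    (hIF : ∀ N : Subgroup (absoluteGaloisGroup ℚ), N.Normal →
      (galoisRepTorsion W (p : ℕ)).ker ≤ N → N.index ≠ p)
    {J J' n : ℕ} (hJ0 : 0 < J) (hJ : J ≤ p ^ n) (hJ' : J' ≤ p ^ n)
    (φ : contOneCocycles (W.modPTwist p κ J).toTopRep)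
    (ψ : contOneCocycles (W.modPTwist p κ.invTwist J').toTopRep)
    {w : (W.modPTwist p κ J).toTopRep × (W.modPTwist p κ.invTwist J').toTopRep}
    (hw : w ∈ contOneCocycles.jointValueSubgroup φ ψ
      ((κ.twistModPRepresentation (W.torsionGaloisModule (p : ℤ))
          (fun P : geomTorsion W (p : ℤ) => AddSubgroup.torsionBy.nsmul P) J).ker ⊓
        (κ.invTwist.twistModPRepresentation (W.torsionGaloisModule (p : ℤ))
          (fun P : geomTorsion W (p : ℤ) => AddSubgroup.torsionBy.nsmul P) J').ker)
      (fun _ hτ x => κ.toTopRep_ρ_apply_eq_self_of_mem_ker (W.torsionGaloisModule (p : ℤ)) _ J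
        (Subgroup.mem_inf.mp hτ).1 x)
      (fun _ hτ y => κ.invTwist.toTopRep_ρ_apply_eq_self_of_mem_ker (W.torsionGaloisModule (p : ℤ))
        _ J' (Subgroup.mem_inf.mp hτ).2 y))
    (S : Set (HeightOneSpectrum (𝓞 ℚ))) (hS : S.Finite) :
    ∃ N : Subgroup (absoluteGaloisGroup ℚ), N.Normal ∧ IsOpen (N : Set (absoluteGaloisGroup ℚ)) ∧
      N ≤ (κ.twistModPRepresentation (W.torsionGaloisModule (p : ℤ))
          (fun P : geomTorsion W (p : ℤ) => AddSubgroup.torsionBy.nsmul P) J).ker ⊓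
        (κ.invTwist.twistModPRepresentation (W.torsionGaloisModule (p : ℤ))
          (fun P : geomTorsion W (p : ℤ) => AddSubgroup.torsionBy.nsmul P) J').ker ∧
      N ≤ κ.layerSubgroup (n + 1) ∧ (∀ σ ∈ N, φ.1 σ = 0) ∧ (∀ σ ∈ N, ψ.1 σ = 0) ∧
      ∃ v ∉ S, SubgroupIsUnramifiedAt ℚ N v ∧
        GaloisRep.IsUnramifiedAt v (W.torsionGaloisModule (p : ℤ)) ∧
        ∃ t : absoluteGaloisGroup ℚ,
          ((W.modPTwist p κ J).toTopRep.ρ t w.1, (W.modPTwist p κ.invTwist J').toTopRep.ρ t w.2) ∈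
              contOneCocycles.jointValueSubgroup φ ψ
                ((κ.twistModPRepresentation (W.torsionGaloisModule (p : ℤ))
                    (fun P : geomTorsion W (p : ℤ) => AddSubgroup.torsionBy.nsmul P) J).ker ⊓
                  (κ.invTwist.twistModPRepresentation (W.torsionGaloisModule (p : ℤ))
                    (fun P : geomTorsion W (p : ℤ) => AddSubgroup.torsionBy.nsmul P) J').ker)
                (fun _ hτ x => κ.toTopRep_ρ_apply_eq_self_of_mem_ker (W.torsionGaloisModule (p : ℤ))
                  _ J (Subgroup.mem_inf.mp hτ).1 x)
                (fun _ hτ y => κ.invTwist.toTopRep_ρ_apply_eq_self_of_mem_ker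
                  (W.torsionGaloisModule (p : ℤ)) _ J' (Subgroup.mem_inf.mp hτ).2 y) ∧
          ∀ Frv : absoluteGaloisGroup (v.adicCompletion ℚ), IsAbsArithFrob Frv →
            absGaloisRestrict ℚ (v.adicCompletion ℚ) Frv ∈
                (κ.twistModPRepresentation (W.torsionGaloisModule (p : ℤ))
                    (fun P : geomTorsion W (p : ℤ) => AddSubgroup.torsionBy.nsmul P) J).ker ⊓
                  (κ.invTwist.twistModPRepresentation (W.torsionGaloisModule (p : ℤ))
                    (fun P : geomTorsion W (p : ℤ) => AddSubgroup.torsionBy.nsmul P) J').ker ∧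
              φ.1 (absGaloisRestrict ℚ (v.adicCompletion ℚ) Frv) =
                (W.modPTwist p κ J).toTopRep.ρ t w.1 ∧
              ψ.1 (absGaloisRestrict ℚ (v.adicCompletion ℚ) Frv) =
                (W.modPTwist p κ.invTwist J').toTopRep.ρ t w.2 ∧
              galoisRepTorsion W p (absGaloisRestrict ℚ (v.adicCompletion ℚ) Frv) = 1 ∧
              W.torsionGaloisModule (p : ℤ) (absGaloisRestrict ℚ (v.adicCompletion ℚ) Frv) = 1 ∧
              absGaloisRestrict ℚ (v.adicCompletion ℚ) Frv ∈ κ.layerSubgroup n ∧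
              absGaloisRestrict ℚ (v.adicCompletion ℚ) Frv ∉ κ.layerSubgroup (n + 1) := by
  -- STEP 2 end-to-end at SOME prime `𝔓 ∣ v` (parent file §7)
  obtain ⟨N, hNn, hNo, hNH, hNL, hNφ, hNψ, v, hvS, hunr, 𝔓, h𝔓, Fr, hFr, hFrH, hφFr, hψFr, -,
      hFrn, hFrn1⟩ :=
    exists_isArithFrobAt_mem_inf_ker_apply_eq_and_depth_of_imageFacts W p κ hSC hIF hJ0 hJ hJ' φ ψ
      hw S hS
  haveI := hNn
  -- the two modules are fixed by `H`
  have hX : ∀ τ ∈ (κ.twistModPRepresentation (W.torsionGaloisModule (p : ℤ))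
          (fun P : geomTorsion W (p : ℤ) => AddSubgroup.torsionBy.nsmul P) J).ker ⊓
        (κ.invTwist.twistModPRepresentation (W.torsionGaloisModule (p : ℤ))
          (fun P : geomTorsion W (p : ℤ) => AddSubgroup.torsionBy.nsmul P) J').ker,
      ∀ x : (W.modPTwist p κ J).toTopRep, (W.modPTwist p κ J).toTopRep.ρ τ x = x :=
    fun _ hτ x => κ.toTopRep_ρ_apply_eq_self_of_mem_ker (W.torsionGaloisModule (p : ℤ)) _ J
      (Subgroup.mem_inf.mp hτ).1 x
  have hY : ∀ τ ∈ (κ.twistModPRepresentation (W.torsionGaloisModule (p : ℤ))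
          (fun P : geomTorsion W (p : ℤ) => AddSubgroup.torsionBy.nsmul P) J).ker ⊓
        (κ.invTwist.twistModPRepresentation (W.torsionGaloisModule (p : ℤ))
          (fun P : geomTorsion W (p : ℤ) => AddSubgroup.torsionBy.nsmul P) J').ker,
      ∀ y : (W.modPTwist p κ.invTwist J').toTopRep,
        (W.modPTwist p κ.invTwist J').toTopRep.ρ τ y = y :=
    fun _ hτ y => κ.invTwist.toTopRep_ρ_apply_eq_self_of_mem_ker (W.torsionGaloisModule (p : ℤ))
      _ J' (Subgroup.mem_inf.mp hτ).2 y
  -- `H ≤ ker ρ̄` (`J ≥ 1`)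
  have hHρ : (κ.twistModPRepresentation (W.torsionGaloisModule (p : ℤ))
          (fun P : geomTorsion W (p : ℤ) => AddSubgroup.torsionBy.nsmul P) J).ker ⊓
        (κ.invTwist.twistModPRepresentation (W.torsionGaloisModule (p : ℤ))
          (fun P : geomTorsion W (p : ℤ) => AddSubgroup.torsionBy.nsmul P) J').ker ≤
      (galoisRepTorsion W p).ker :=
    inf_le_left.trans (ker_twistModPRepresentation_le_ker W p κ hJ0)
  -- Frobenius transport to the distinguished prime of `v`
  obtain ⟨t, ht⟩ := exists_forall_isAbsArithFrob_conj_mul_inv_mem N hunr h𝔓 hFr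
  refine ⟨N, hNn, hNo, hNH, hNL, hNφ, hNψ, v, hvS, hunr, ?_, t⁻¹, ?_, fun Frv hFrv => ?_⟩
  · -- `E[p]` is unramified at `v`: inertia `≤ N ≤ H ≤ ker ρ̄`
    intro 𝔔 h𝔔 σ hσ
    have h1 : galoisRepTorsion W p σ = 1 := MonoidHom.mem_ker.mp (hHρ (hNH (hunr 𝔔 h𝔔 hσ)))
    exact LinearMap.ext fun P => by
      rw [torsionGaloisModule_apply_apply]
      exact forall_smul_eq_of_galoisRepTorsion_eq_one W p h1 P
  · -- the translate lies in `M`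
    exact contOneCocycles.smul_mem_jointValueSubgroup φ ψ _ hX hY t⁻¹ hw
  · -- every local Frobenius: `t·(res Fr_v)·t⁻¹ ∈ Fr·N`
    have hτN : t * absGaloisRestrict ℚ (v.adicCompletion ℚ) Frv * t⁻¹ * Fr⁻¹ ∈ N := ht Frv hFrv
    obtain ⟨hτH, hφτ⟩ := JointValue.mem_and_apply_eq_of_mul_inv_mem φ _ hX hNH hNφ hFrH hτN
    obtain ⟨-, hψτ⟩ := JointValue.mem_and_apply_eq_of_mul_inv_mem ψ _ hY hNH hNψ hFrH hτN
    have hconj : t⁻¹ * (t * absGaloisRestrict ℚ (v.adicCompletion ℚ) Frv * t⁻¹) * t =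
        absGaloisRestrict ℚ (v.adicCompletion ℚ) Frv := by group
    have hrH : absGaloisRestrict ℚ (v.adicCompletion ℚ) Frv ∈
        (κ.twistModPRepresentation (W.torsionGaloisModule (p : ℤ))
            (fun P : geomTorsion W (p : ℤ) => AddSubgroup.torsionBy.nsmul P) J).ker ⊓
          (κ.invTwist.twistModPRepresentation (W.torsionGaloisModule (p : ℤ))
            (fun P : geomTorsion W (p : ℤ) => AddSubgroup.torsionBy.nsmul P) J').ker := by
      have h := Subgroup.Normal.conj_mem inferInstance _ hτH t⁻¹
      rwa [inv_inv, hconj] at h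
    have hρr : galoisRepTorsion W p (absGaloisRestrict ℚ (v.adicCompletion ℚ) Frv) = 1 :=
      MonoidHom.mem_ker.mp (hHρ hrH)
    -- depth: membership in the layers is constant on `Fr·N` (`N ≤ Γ_{n+1} ≤ Γ_n`) and conjugation invariant
    have hτn : t * absGaloisRestrict ℚ (v.adicCompletion ℚ) Frv * t⁻¹ ∈ κ.layerSubgroup n :=
      (JointValue.mem_iff_mem_of_mul_inv_mem
        (hNL.trans (κ.layerSubgroup_antitone (Nat.le_succ n))) hτN).mpr hFrn
    have hτn1 : t * absGaloisRestrict ℚ (v.adicCompletion ℚ) Frv * t⁻¹ ∉ κ.layerSubgroup (n + 1) :=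
      fun h => hFrn1 ((JointValue.mem_iff_mem_of_mul_inv_mem hNL hτN).mp h)
    refine ⟨hrH, ?_, ?_, hρr, ?_, ?_, ?_⟩
    · rw [← hconj, JointValue.apply_inv_mul_mul_of_fixed φ (hX _ hτH) t, hφτ, hφFr]
    · rw [← hconj, JointValue.apply_inv_mul_mul_of_fixed ψ (hY _ hτH) t, hψτ, hψFr]
    · exact LinearMap.ext fun P => by
        rw [torsionGaloisModule_apply_apply]
        exact forall_smul_eq_of_galoisRepTorsion_eq_one W p hρr P
    · have h := Subgroup.Normal.conj_mem inferInstance _ hτn t⁻¹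
      rwa [inv_inv, hconj] at h
    · intro h
      exact hτn1 (Subgroup.Normal.conj_mem inferInstance _ h t)

end Summit.BirchSwinnertonDyer.BirchSwinnertonDyer.Rank1Residual

end
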